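/-
Copyright (c) 2026 the pub-hodgecm-mathlib formalisation cell (harness21).  Prover seat hodgecm-mathlib-K2E4-p23 (g2), Track B ∕ K2-LIT, h413 =
`stmt-HodgeConjecture-24833`, ENGINE E1, 5Res campaign «ENDGAME BY FAMILIES», RUNG 1, deal (273)(iii) plan (P3)-pre: the TWO-FAMILY edition of the RUNG-1 plug — off-dual and
self-dual blocks carry model spaces of DIFFERENT types, so the FINAL feeds two block families; this file is ★ p860902 §2∕§3 for two families, letters plugged identically.
-/
import Summits.HodgeConjecture.HodgeConjecture.Theorems.K2E1ResidualSphericalFiniteMaximalLevelCMTwoOfBlocks   -- ★ p860902 (this seat): `hD5_letterFree_two` + everything it imports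
import Mathlib.Analysis.InnerProductSpace.Projection.Submodule
import HarnessLib

/-!
# K2·E1 — `K2E1ResidualSphericalFiniteOfTwoBlockFamilies`: RUNG 1 PLUGGED FOR TWO BLOCK FAMILIES (off-dual ⊕ self-dual) — «`(L²_res(U(J)_{L∕L⁺}))^{K_∞·K′_f}` is
# finite-dimensional» modulo `hEis` over BOTH families and the per-block model letters of EACH family (deal (273)(iii), the device the FINAL needs: OD and SD models have different types)

Track B ∕ K2-LIT, crux h413 = `stmt-HodgeConjecture-24833`, route of record `HCCMUnconditional`; cell `hodgecm-mathlib`, squad K2, ENGINE E1.  Prover seat `hodgecm-mathlib-K2E4-p23` (g2).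
THEOREMS ONLY (no `def`, no `instance`, no notation, no named-fact hypothesis, no `sorry`); lane `--supports stmt-HodgeConjecture-24833 --as helper` (count-neutral).  CLOSES NO SOCKET.

AMENDMENT #4 CURRENCY (R2, «S₀-supported atoms», two-family form): family 1 = the OFF-DUAL blocks — ANY index set `S₁` (at `K_∞·K_max,f` it is an infinite discrete `ℤ^{d−1}`-family, A4 §0(B)) with
NO atoms (`[∀ b, Subsingleton (A₁ b)]`, A4 §1: OD ⇒ pure `L²`); family 2 = the SELF-DUAL blocks — `[Finite S₂]` (A4 R1 `selfDual_families_finite`) with finite-dimensional atoms.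
WHY TWO FAMILIES.  ★ p860902 §3 takes ONE block family `b : S` with dependent model data `A b, Ω b, m b, E b`; the FINAL has two KINDS of blocks — off-dual (`L²(ℝ × K_U)` lines, no atoms; K2E4-p14's
package) and self-dual (`(⊕_c W) ⊕ L²((0,∞); W)`; ★ p860865) — whose model TYPES differ, and a type family defined by cases on a predicate is not instance-transparent.  So the exhaustion
∕ atoms ∕ `hatoms` chain is re-run here for TWO index types `S₁, S₂` (abstract §1–§2, generic `𝒢` §3, `U(J)` §4): same mathematics, no case analysis on types.
* §1 (abstract Hilbert space) `eq_zero_of_mem_closure_of_starProjection_eq_zero₂` (a vector in the closure of `(⨆ Blk₁) ⊔ (⨆ Blk₂)` killed by every block projection is `0` — no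
  orthogonality needed), **`hEXH₂`** (block coordinates injective on the blocks ⇒ jointly injective on `Eis`), `finiteDimensional_atom₂`, **`exists_atom_of_noLineMass₂`**.
* §2 (generic `𝒢`) **`hatoms_of_noLineMass₂`** — ★ `hatoms_of_noLineMass` for two families.
* §3 (`U(J)(𝔸_{L⁺})`, K2E2-p12's frame) **`hatoms_trivialKType_letterFree_of_twoBlockFamilies`**, **`residual_invariants_finiteDimensional_letterFree_of_twoBlockFamilies`** — ★ p860902 §2∕§3
  with `(gen₁, V₁, …)` and `(gen₂, V₂, …)`, `hEis : Eis(Kad) ≤ closure ((⨆ b, block₁ b) ⊔ (⨆ b, block₂ b))`; letters plugged as there (`hPfix` ★ p860649, `hPEis` ★ p860688∕p860758, `hD5` ★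
  `hD5_letterFree_two` per family, top ★ K2E4-p14 generic).
HONEST LABEL: HC_CM is proved only modulo the 7 printed citations (2 remaining named inputs: hLiu418 = `stmt-HodgeConjecture-24832`, h413 = `stmt-HodgeConjecture-24833`) until rung 0
closes; this file asserts no named fact, is conditional by construction on the visible binders, and closes no socket; count-neutral; RUNG 1 (mod block packages) ≠ 5Res.

## References
* [MoeglinWaldspurger1995] C. Mœglin, J.-L. Waldspurger, *Spectral decomposition and Eisenstein series* (1995), I.2.18, II.2.4, V.3.13, VI.2.
* [ReedSimonI1980] M. Reed, B. Simon, *Methods of Modern Mathematical Physics I* (1980), Thm. II.3.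
* [HarishChandra1968] Harish-Chandra, *Automorphic forms on semisimple Lie groups*, LNM 62 (1968), Thm. 1.
-/

set_option autoImplicit false
-- the mandated namespace repeats the single-problem summit's segment (`HodgeConjecture.HodgeConjecture`)
set_option linter.dupNamespace false

noncomputable section

open MeasureTheory MeasureTheory.Measure Filter Topology CompactlySupported NumberField NumberField.mixedEmbedding NumberField.InfinitePlace ContRepresentation Set
open scoped InnerProductSpace ENNReal ComplexConjugate NNReal
open Literature.NumberTheory.Automorphic Literature.NumberTheory.Automorphic.UnitaryGroup AdelicGroupData
open Summit.HodgeConjecture.HodgeConjecture.Cruxes.H413.K2E1ResidualPartInAtomsCMTwo (hPEis_of_letters hEisdef_of_trivial_kType)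
open Summit.HodgeConjecture.HodgeConjecture.Cruxes.H413.K2E1ResidualAtomsMaximalLevelCMTwo (hPfix_trivialKType hχmul_of_one hχinv_of_one)
open Summit.HodgeConjecture.HodgeConjecture.Cruxes.H413.K2E1ResidualSphericalFiniteMaximalLevelCMTwoOfBlocks (hD5_letterFree_two)
open Summit.HodgeConjecture.HodgeConjecture.Cruxes.H413.K2E1CuspidalSpectrumUnitary

namespace Summit.HodgeConjecture.HodgeConjecture.Cruxes.H413.K2E1ResidualSphericalFiniteOfTwoBlockFamilies

universe u

/-! ## §1 Abstract: exhaustion and atoms for two block families -/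

section Abstract

variable {H : Type*} [NormedAddCommGroup H] [InnerProductSpace ℂ H] [CompleteSpace H] {S₁ S₂ : Type*}

/-- A vector in the closure of `(⨆ Blk₁) ⊔ (⨆ Blk₂)` annihilated by EVERY block projection vanishes (it is orthogonal to each block, hence to the closure `= Kᗮᗮ`, hence to itself).
No pairwise orthogonality of the blocks is needed. [cite: ReedSimonI1980, Thm. II.3] -/
theorem eq_zero_of_mem_closure_of_starProjection_eq_zero₂ (Blk₁ : S₁ → Submodule ℂ H) (Blk₂ : S₂ → Submodule ℂ H)
    [∀ b, (Blk₁ b).HasOrthogonalProjection] [∀ b, (Blk₂ b).HasOrthogonalProjection] {x : H}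
    (hx : x ∈ ((⨆ b, Blk₁ b) ⊔ (⨆ b, Blk₂ b)).topologicalClosure)
    (h₁ : ∀ b, (Blk₁ b).starProjection x = 0) (h₂ : ∀ b, (Blk₂ b).starProjection x = 0) : x = 0 := by
  have hperp : x ∈ ((⨆ b, Blk₁ b) ⊔ (⨆ b, Blk₂ b))ᗮ := by
    rw [← Submodule.inf_orthogonal, ← Submodule.iInf_orthogonal, ← Submodule.iInf_orthogonal]
    exact Submodule.mem_inf.2 ⟨(Submodule.mem_iInf _).2 fun b => (Submodule.starProjection_apply_eq_zero_iff _).1 (h₁ b),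
      (Submodule.mem_iInf _).2 fun b => (Submodule.starProjection_apply_eq_zero_iff _).1 (h₂ b)⟩
  have hx' : x ∈ ((⨆ b, Blk₁ b) ⊔ (⨆ b, Blk₂ b))ᗮᗮ := by rwa [Submodule.orthogonal_orthogonal_eq_closure]
  have h0 : ⟪x, x⟫_ℂ = 0 := Submodule.inner_right_of_mem_orthogonal hperp hx'
  exact inner_self_eq_zero.1 h0

variable {A₁ L₁ : S₁ → Type*} [∀ b, AddCommGroup (A₁ b)] [∀ b, Module ℂ (A₁ b)] [∀ b, AddCommGroup (L₁ b)] [∀ b, Module ℂ (L₁ b)]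
  {A₂ L₂ : S₂ → Type*} [∀ b, AddCommGroup (A₂ b)] [∀ b, Module ℂ (A₂ b)] [∀ b, AddCommGroup (L₂ b)] [∀ b, Module ℂ (L₂ b)]

/-- **(EXH) FOR TWO FAMILIES**: block coordinates injective on the (complete) blocks are jointly injective on any `Eis ≤ closure ((⨆ Blk₁) ⊔ (⨆ Blk₂))`, in the `U b := V b ∘ P_{Blk b}` currency.
[cite: MoeglinWaldspurger1995, II.2.4, V.3.13] -/
theorem hEXH₂ (Blk₁ : S₁ → Submodule ℂ H) (Blk₂ : S₂ → Submodule ℂ H) [∀ b, (Blk₁ b).HasOrthogonalProjection] [∀ b, (Blk₂ b).HasOrthogonalProjection]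
    (Eis : Submodule ℂ H) (hEis : Eis ≤ ((⨆ b, Blk₁ b) ⊔ (⨆ b, Blk₂ b)).topologicalClosure)
    (V₁ : ∀ b, H →ₗ[ℂ] (A₁ b × L₁ b)) (hV₁ : ∀ b, ∀ y ∈ Blk₁ b, V₁ b y = 0 → y = 0)
    (V₂ : ∀ b, H →ₗ[ℂ] (A₂ b × L₂ b)) (hV₂ : ∀ b, ∀ y ∈ Blk₂ b, V₂ b y = 0 → y = 0) :
    ∀ x ∈ Eis, (∀ b, (V₁ b ∘ₗ ((Blk₁ b).starProjection : H →L[ℂ] H).toLinearMap) x = 0) →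
      (∀ b, (V₂ b ∘ₗ ((Blk₂ b).starProjection : H →L[ℂ] H).toLinearMap) x = 0) → x = 0 := by
  intro x hx h1 h2
  exact eq_zero_of_mem_closure_of_starProjection_eq_zero₂ Blk₁ Blk₂ (hEis hx)
    (fun b => hV₁ b _ ((Blk₁ b).starProjection_apply_mem x) (h1 b)) (fun b => hV₂ b _ ((Blk₂ b).starProjection_apply_mem x) (h2 b))

omit [CompleteSpace H] in
/-- **TWO FAMILIES, NO LINE MASS ⟹ FINITE-DIMENSIONAL** (AMENDMENT #4 currency: family 1 has NO atoms — `A₁ b` subsingleton, ANY index `S₁`; family 2 is FINITE):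
`Eis ⊓ ⨅ ker(snd ∘ U₁ b) ⊓ ⨅ ker(snd ∘ U₂ b)` embeds in `Π_{b : S₂} A₂ b`. [cite: MoeglinWaldspurger1995, V.3.13] -/
theorem finiteDimensional_atom₂ [∀ b, Subsingleton (A₁ b)] [Finite S₂] [∀ b, FiniteDimensional ℂ (A₂ b)]
    (Eis : Submodule ℂ H) (U₁ : ∀ b, H →ₗ[ℂ] (A₁ b × L₁ b)) (U₂ : ∀ b, H →ₗ[ℂ] (A₂ b × L₂ b))
    (hEXH : ∀ x ∈ Eis, (∀ b, U₁ b x = 0) → (∀ b, U₂ b x = 0) → x = 0) :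
    FiniteDimensional ℂ ↥(Eis ⊓ (⨅ b, LinearMap.ker ((LinearMap.snd ℂ (A₁ b) (L₁ b)) ∘ₗ U₁ b)) ⊓ ⨅ b, LinearMap.ker ((LinearMap.snd ℂ (A₂ b) (L₂ b)) ∘ₗ U₂ b)) := by
  set M : Submodule ℂ H := Eis ⊓ (⨅ b, LinearMap.ker ((LinearMap.snd ℂ (A₁ b) (L₁ b)) ∘ₗ U₁ b)) ⊓ ⨅ b, LinearMap.ker ((LinearMap.snd ℂ (A₂ b) (L₂ b)) ∘ₗ U₂ b) with hM
  let Φ : M →ₗ[ℂ] (∀ b, A₂ b) := LinearMap.pi fun b => (LinearMap.fst ℂ (A₂ b) (L₂ b)) ∘ₗ U₂ b ∘ₗ M.subtype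
  refine FiniteDimensional.of_injective Φ ((injective_iff_map_eq_zero Φ).2 fun x hx => ?_)
  obtain ⟨hx12, hx2⟩ := Submodule.mem_inf.1 x.2
  obtain ⟨hxE, hx1⟩ := Submodule.mem_inf.1 hx12
  have hU1 : ∀ b, U₁ b (x : H) = 0 := fun b => Prod.ext (Subsingleton.elim _ _) (by
    have h := (Submodule.mem_iInf _).1 hx1 b
    rwa [LinearMap.mem_ker] at h)
  have hU2 : ∀ b, U₂ b (x : H) = 0 := fun b => Prod.ext (congrFun hx b) (by
    have h := (Submodule.mem_iInf _).1 hx2 b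
    rwa [LinearMap.mem_ker] at h)
  exact Subtype.ext (hEXH _ hxE hU1 hU2)

omit [CompleteSpace H] in
/-- **TWO FAMILIES, (EXH) + NO LINE MASS ⟹ AN ATOM**. [cite: MoeglinWaldspurger1995, V.3.13] -/
theorem exists_atom_of_noLineMass₂ [∀ b, Subsingleton (A₁ b)] [Finite S₂] [∀ b, FiniteDimensional ℂ (A₂ b)]
    (Eis : Submodule ℂ H) (U₁ : ∀ b, H →ₗ[ℂ] (A₁ b × L₁ b)) (U₂ : ∀ b, H →ₗ[ℂ] (A₂ b × L₂ b))
    (hEXH : ∀ x ∈ Eis, (∀ b, U₁ b x = 0) → (∀ b, U₂ b x = 0) → x = 0) {ι : Type*} (S : Set ι) (f : ι → Submodule ℂ H) (P : H → H)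
    (hPEis : ∀ i ∈ S, ∀ w ∈ f i, P w ∈ Eis) (hD5₁ : ∀ i ∈ S, ∀ w ∈ f i, ∀ b, (U₁ b (P w)).2 = 0) (hD5₂ : ∀ i ∈ S, ∀ w ∈ f i, ∀ b, (U₂ b (P w)).2 = 0) :
    ∃ Aχ : Submodule ℂ H, FiniteDimensional ℂ Aχ ∧ ∀ i ∈ S, ∀ w ∈ f i, P w ∈ Aχ :=
  ⟨_, finiteDimensional_atom₂ Eis U₁ U₂ hEXH, fun i hi w hw => Submodule.mem_inf.2 ⟨Submodule.mem_inf.2 ⟨hPEis i hi w hw, (Submodule.mem_iInf _).2 fun b => by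
      rw [LinearMap.mem_ker, LinearMap.comp_apply, LinearMap.snd_apply]; exact hD5₁ i hi w hw b⟩, (Submodule.mem_iInf _).2 fun b => by
      rw [LinearMap.mem_ker, LinearMap.comp_apply, LinearMap.snd_apply]; exact hD5₂ i hi w hw b⟩⟩

end Abstract

/-! ## §2 Generic `𝒢`: the `hatoms` clause from two families -/

section Generic

variable {F : Type} [Field F] [NumberField F] (𝒢 : AdelicGroupData.{u} F) (μ : Measure 𝒢.automorphicQuotient) [𝒢.IsAutomorphicMeasure μ] (𝔓 : 𝒢.ParabolicUnipotentData)
  {S₁ S₂ : Type*} [Finite S₂]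
  {A₁ L₁ : S₁ → Type*} [∀ b, AddCommGroup (A₁ b)] [∀ b, Module ℂ (A₁ b)] [∀ b, Subsingleton (A₁ b)] [∀ b, AddCommGroup (L₁ b)] [∀ b, Module ℂ (L₁ b)]
  {A₂ L₂ : S₂ → Type*} [∀ b, AddCommGroup (A₂ b)] [∀ b, Module ℂ (A₂ b)] [∀ b, FiniteDimensional ℂ (A₂ b)] [∀ b, AddCommGroup (L₂ b)] [∀ b, Module ℂ (L₂ b)]

/-- **★ `hatoms_of_noLineMass` FOR TWO FAMILIES** (generic `𝒢`). [cite: MoeglinWaldspurger1995, I.2.18 and V.3.13] -/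
theorem hatoms_of_noLineMass₂
    {K : Type*} [Group K] (ιK : K →* 𝒢.Adelic) {T : Type*} [Group T] (ιa : T →* K) {Kf : Type*} [Group Kf] [TopologicalSpace Kf] (ιf : Kf →* K)
    (χ : T →* ℂ) (U₀ : OpenSubgroup Kf) (P : 𝒢.L2 μ →L[ℂ] 𝒢.L2 μ)
    (hPfix : ∀ x : 𝒢.L2 μ, (∀ u ∈ U₀, 𝒢.rightRegular μ (ιK (ιf u)) x = x) → (∀ t : T, 𝒢.rightRegular μ (ιK (ιa t)) x = χ t • x) → P x = x)
    (Eis : Submodule ℂ (𝒢.L2 μ)) (U₁ : ∀ b, 𝒢.L2 μ →ₗ[ℂ] (A₁ b × L₁ b)) (U₂ : ∀ b, 𝒢.L2 μ →ₗ[ℂ] (A₂ b × L₂ b))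
    (hEXH : ∀ x ∈ Eis, (∀ b, U₁ b x = 0) → (∀ b, U₂ b x = 0) → x = 0)
    (hPEis : ∀ W : ClosedSubrep (𝒢.rightRegular μ), W.toContRep.IsTopIrreducible → W ≤ residualSubspace 𝒢 μ 𝔓 → ∀ w ∈ W, P w ∈ Eis)
    (hD5₁ : ∀ W : ClosedSubrep (𝒢.rightRegular μ), W.toContRep.IsTopIrreducible → W ≤ residualSubspace 𝒢 μ 𝔓 → ∀ w ∈ W, ∀ b, (U₁ b (P w)).2 = 0)
    (hD5₂ : ∀ W : ClosedSubrep (𝒢.rightRegular μ), W.toContRep.IsTopIrreducible → W ≤ residualSubspace 𝒢 μ 𝔓 → ∀ w ∈ W, ∀ b, (U₂ b (P w)).2 = 0) :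
    ∃ (P : 𝒢.L2 μ →L[ℂ] 𝒢.L2 μ) (A : Submodule ℂ (𝒢.L2 μ)), FiniteDimensional ℂ A ∧
      (∀ x : 𝒢.L2 μ, (∀ u ∈ U₀, 𝒢.rightRegular μ (ιK (ιf u)) x = x) → (∀ t : T, 𝒢.rightRegular μ (ιK (ιa t)) x = χ t • x) → P x = x) ∧
      ∀ W : ClosedSubrep (𝒢.rightRegular μ), W.toContRep.IsTopIrreducible → W ≤ residualSubspace 𝒢 μ 𝔓 → ∀ w ∈ W, P w ∈ A := by
  obtain ⟨Aχ, hAχ, hmem⟩ := exists_atom_of_noLineMass₂ Eis U₁ U₂ hEXH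
    {W : ClosedSubrep (𝒢.rightRegular μ) | W.toContRep.IsTopIrreducible ∧ W ≤ residualSubspace 𝒢 μ 𝔓} (fun W => W.toSubmodule) P
    (fun W hW w hw => hPEis W hW.1 hW.2 w hw) (fun W hW w hw b => hD5₁ W hW.1 hW.2 w hw b) (fun W hW w hw b => hD5₂ W hW.1 hW.2 w hw b)
  exact ⟨P, Aχ, hAχ, hPfix, fun W hWirr hWle w hw => hmem W ⟨hWirr, hWle⟩ w hw⟩

end Generic

/-! ## §3 `U(J)(𝔸_{L⁺})`, K2E2-p12's frame: RUNG 1 plugged for two block families -/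

section CM

variable {L : Type} [Field L] [NumberField L] [IsCMField L] (J : Matrix (Fin 2) (Fin 2) L)
  (μ : Measure (cmDatum L 2 J).automorphicQuotient) [(cmDatum L 2 J).IsAutomorphicMeasure μ]
  [MeasurableSpace (UnitaryGroup.arch (↥(maximalRealSubfield L)) L (IsCMField.complexConj L) 2 J)] [BorelSpace (UnitaryGroup.arch (↥(maximalRealSubfield L)) L (IsCMField.complexConj L) 2 J)]
  [MeasurableSpace (finAdelic (↥(maximalRealSubfield L)) L (IsCMField.complexConj L) 2 J)] [BorelSpace (finAdelic (↥(maximalRealSubfield L)) L (IsCMField.complexConj L) 2 J)]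
  (νinf : Measure (UnitaryGroup.arch (↥(maximalRealSubfield L)) L (IsCMField.complexConj L) 2 J)) [IsHaarMeasure νinf] [νinf.IsInvInvariant] [SFinite νinf]
  (νf : Measure (finAdelic (↥(maximalRealSubfield L)) L (IsCMField.complexConj L) 2 J)) [IsFiniteMeasureOnCompacts νf] [νf.IsMulLeftInvariant] [νf.IsInvInvariant] [νf.IsOpenPosMeasure]
  [MeasurableSpace ↥(UnitaryGroup.arch (↥(maximalRealSubfield L)) L (IsCMField.complexConj L) 2 J ⊓ unitaryGroupOfForm (conjMixed (↥(maximalRealSubfield L)) L (IsCMField.complexConj L)) 1)] [BorelSpace ↥(UnitaryGroup.arch (↥(maximalRealSubfield L)) L (IsCMField.complexConj L) 2 J ⊓ unitaryGroupOfForm (conjMixed (↥(maximalRealSubfield L)) L (IsCMField.complexConj L)) 1)]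
  (μK : Measure ↥(UnitaryGroup.arch (↥(maximalRealSubfield L)) L (IsCMField.complexConj L) 2 J ⊓ unitaryGroupOfForm (conjMixed (↥(maximalRealSubfield L)) L (IsCMField.complexConj L)) 1)) [IsProbabilityMeasure μK] [μK.IsMulLeftInvariant] [μK.IsMulRightInvariant] [μK.IsInvInvariant]
  (χ : C_c(↥(UnitaryGroup.arch (↥(maximalRealSubfield L)) L (IsCMField.complexConj L) 2 J ⊓ unitaryGroupOfForm (conjMixed (↥(maximalRealSubfield L)) L (IsCMField.complexConj L)) 1), ℂ)) (e : C_c(finAdelic (↥(maximalRealSubfield L)) L (IsCMField.complexConj L) 2 J, ℂ))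

/-- **`hatoms` AT `(1, K′)` FROM TWO BLOCK FAMILIES** (★ p860902 §2 for `(gen₁, V₁, …)` and `(gen₂, V₂, …)`, `hEis` over the closed sum of both). [cite: MoeglinWaldspurger1995, I.2.18, V.3.13] -/
theorem hatoms_trivialKType_letterFree_of_twoBlockFamilies [MeasurableMul (finAdelic (↥(maximalRealSubfield L)) L (IsCMField.complexConj L) 2 J)] [ENNReal.HolderTriple ∞ 2 2]
    (hJc : J.map (IsCMField.complexConj L : L → L) = J) (hJ2 : J * J = 1)
    (hJw : ∀ w : {w : InfinitePlace L // IsComplex w}, J.map w.1.embedding = !![(0 : ℂ), 1; 1, 0])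
    (hχ1 : ∀ k, χ k = 1)
    (K' : Subgroup (finAdelic (↥(maximalRealSubfield L)) L (IsCMField.complexConj L) 2 J)) (hK'o : IsOpen (K' : Set (finAdelic (↥(maximalRealSubfield L)) L (IsCMField.complexConj L) 2 J))) (he0 : ∀ x, x ∉ K' → e x = 0) (he1 : ∫ x, e x ∂νf = 1)
    (heK : ∀ k ∈ K', ∀ x, e (k * x) = e x) (hestar : ∀ x, mulStar (⇑e) x = e x)
    (P : (cmDatum L 2 J).L2 μ →L[ℂ] (cmDatum L 2 J).L2 μ) (hPdef : P = ((((cmDatum L 2 J).rightRegular μ).restrict ((archToAdelic (↥(maximalRealSubfield L)) L (IsCMField.complexConj L) 2 J).comp (Subgroup.inclusion (inf_le_left : UnitaryGroup.arch (↥(maximalRealSubfield L)) L (IsCMField.complexConj L) 2 J ⊓ unitaryGroupOfForm (conjMixed (↥(maximalRealSubfield L)) L (IsCMField.complexConj L)) 1 ≤ UnitaryGroup.arch (↥(maximalRealSubfield L)) L (IsCMField.complexConj L) 2 J)))).integratedOperator (((cmDatum L 2 J).isUnitary_rightRegular μ).restrict _)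
          (((cmDatum L 2 J).isStronglyContinuous_rightRegular_holds μ).restrict _ ((continuous_archToAdelic (↥(maximalRealSubfield L)) L (IsCMField.complexConj L) 2 J).comp (continuous_induced_rng.2 continuous_subtype_val))) μK χ ∘L
        (((cmDatum L 2 J).rightRegular μ).restrict (finAdelicToAdelic (↥(maximalRealSubfield L)) L (IsCMField.complexConj L) 2 J)).integratedOperator (((cmDatum L 2 J).isUnitary_rightRegular μ).restrict _) (((cmDatum L 2 J).isStronglyContinuous_rightRegular_holds μ).restrict _ (continuous_finAdelicToAdelic (↥(maximalRealSubfield L)) L (IsCMField.complexConj L) 2 J)) νf e))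
    (𝔓 : (cmDatum L 2 J).ParabolicUnipotentData)
    (Kad : Subgroup (cmDatum L 2 J).Adelic) (hKad : Kad ≤ (Subgroup.closure (Set.range (fun k : ↥(UnitaryGroup.arch (↥(maximalRealSubfield L)) L (IsCMField.complexConj L) 2 J ⊓ unitaryGroupOfForm (conjMixed (↥(maximalRealSubfield L)) L (IsCMField.complexConj L)) 1) => (archToAdelic (↥(maximalRealSubfield L)) L (IsCMField.complexConj L) 2 J) ((Subgroup.inclusion (inf_le_left : UnitaryGroup.arch (↥(maximalRealSubfield L)) L (IsCMField.complexConj L) 2 J ⊓ unitaryGroupOfForm (conjMixed (↥(maximalRealSubfield L)) L (IsCMField.complexConj L)) 1 ≤ UnitaryGroup.arch (↥(maximalRealSubfield L)) L (IsCMField.complexConj L) 2 J)) k)) ∪ (finAdelicToAdelic (↥(maximalRealSubfield L)) L (IsCMField.complexConj L) 2 J) '' (K' : Set (finAdelic (↥(maximalRealSubfield L)) L (IsCMField.complexConj L) 2 J)))))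
    {S₁ : Type*} (gen₁ : S₁ → Set ((cmDatum L 2 J).L2 μ))
    {A₁ : S₁ → Type*} [∀ b, AddCommGroup (A₁ b)] [∀ b, Module ℂ (A₁ b)] [∀ b, Subsingleton (A₁ b)]
    {Ω₁ : S₁ → Type*} {mΩ₁ : ∀ b, MeasurableSpace (Ω₁ b)} (m₁ : ∀ b, Measure (Ω₁ b)) {E₁ : S₁ → Type*} [∀ b, NormedAddCommGroup (E₁ b)] [∀ b, NormedSpace ℂ (E₁ b)]
    (V₁ : ∀ b, (cmDatum L 2 J).L2 μ →ₗ[ℂ] (A₁ b × Lp (E₁ b) 2 (m₁ b)))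
    (hV₁ : ∀ b, ∀ y ∈ (Submodule.span ℂ (gen₁ b)).topologicalClosure, V₁ b y = 0 → y = 0)
    (Jb₁ : S₁ → Type*) [∀ b, Countable (Jb₁ b)]
    (h₁ : ∀ b, Jb₁ b → C_c(UnitaryGroup.arch (↥(maximalRealSubfield L)) L (IsCMField.complexConj L) 2 J, ℂ))
    (hhl₁ : ∀ b (j : Jb₁ b) (k : ↥(UnitaryGroup.arch (↥(maximalRealSubfield L)) L (IsCMField.complexConj L) 2 J ⊓ unitaryGroupOfForm (conjMixed (↥(maximalRealSubfield L)) L (IsCMField.complexConj L)) 1)) (x : UnitaryGroup.arch (↥(maximalRealSubfield L)) L (IsCMField.complexConj L) 2 J), h₁ b j ((Subgroup.inclusion (inf_le_left : UnitaryGroup.arch (↥(maximalRealSubfield L)) L (IsCMField.complexConj L) 2 J ⊓ unitaryGroupOfForm (conjMixed (↥(maximalRealSubfield L)) L (IsCMField.complexConj L)) 1 ≤ UnitaryGroup.arch (↥(maximalRealSubfield L)) L (IsCMField.complexConj L) 2 J)) k * x) = χ k * h₁ b j x)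
    (hhr₁ : ∀ b (j : Jb₁ b) (k : ↥(UnitaryGroup.arch (↥(maximalRealSubfield L)) L (IsCMField.complexConj L) 2 J ⊓ unitaryGroupOfForm (conjMixed (↥(maximalRealSubfield L)) L (IsCMField.complexConj L)) 1)) (x : UnitaryGroup.arch (↥(maximalRealSubfield L)) L (IsCMField.complexConj L) 2 J), h₁ b j (x * (Subgroup.inclusion (inf_le_left : UnitaryGroup.arch (↥(maximalRealSubfield L)) L (IsCMField.complexConj L) 2 J ⊓ unitaryGroupOfForm (conjMixed (↥(maximalRealSubfield L)) L (IsCMField.complexConj L)) 1 ≤ UnitaryGroup.arch (↥(maximalRealSubfield L)) L (IsCMField.complexConj L) 2 J)) k) = χ k * h₁ b j x)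
    (s₁ : ∀ b, Jb₁ b → Ω₁ b → ℂ) (hs₁ : ∀ b j, MemLp (s₁ b j) ∞ (m₁ b))
    (hU₁ : ∀ b j, ∀ v ∈ LinearMap.eqLocus (P : (cmDatum L 2 J).L2 μ →ₗ[ℂ] (cmDatum L 2 J).L2 μ) LinearMap.id,
      ((V₁ b ∘ₗ (((Submodule.span ℂ (gen₁ b)).topologicalClosure).starProjection : (cmDatum L 2 J).L2 μ →L[ℂ] (cmDatum L 2 J).L2 μ).toLinearMap) (((((cmDatum L 2 J).rightRegular μ).restrict (archToAdelic (↥(maximalRealSubfield L)) L (IsCMField.complexConj L) 2 J)).integratedOperator (((cmDatum L 2 J).isUnitary_rightRegular μ).restrict _) (((cmDatum L 2 J).isStronglyContinuous_rightRegular_holds μ).restrict _ (continuous_archToAdelic (↥(maximalRealSubfield L)) L (IsCMField.complexConj L) 2 J)) νinf (h₁ b j) ∘L (((cmDatum L 2 J).rightRegular μ).restrict (finAdelicToAdelic (↥(maximalRealSubfield L)) L (IsCMField.complexConj L) 2 J)).integratedOperator (((cmDatum L 2 J).isUnitary_rightRegular μ).restrict _) (((cmDatum L 2 J).isStronglyContinuous_rightRegular_holds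 μ).restrict _ (continuous_finAdelicToAdelic (↥(maximalRealSubfield L)) L (IsCMField.complexConj L) 2 J)) νf e) v)).2 = ((hs₁ b j).toLp (s₁ b j) • ((V₁ b ∘ₗ (((Submodule.span ℂ (gen₁ b)).topologicalClosure).starProjection : (cmDatum L 2 J).L2 μ →L[ℂ] (cmDatum L 2 J).L2 μ).toLinearMap) v).2 : Lp (E₁ b) 2 (m₁ b)))
    (hline₁ : ∀ b (c : Jb₁ b → ℂ), m₁ b {x | ∀ j, s₁ b j x = c j} = 0)
    {S₂ : Type*} [Finite S₂] (gen₂ : S₂ → Set ((cmDatum L 2 J).L2 μ))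
    {A₂ : S₂ → Type*} [∀ b, AddCommGroup (A₂ b)] [∀ b, Module ℂ (A₂ b)] [∀ b, FiniteDimensional ℂ (A₂ b)]
    {Ω₂ : S₂ → Type*} {mΩ₂ : ∀ b, MeasurableSpace (Ω₂ b)} (m₂ : ∀ b, Measure (Ω₂ b)) {E₂ : S₂ → Type*} [∀ b, NormedAddCommGroup (E₂ b)] [∀ b, NormedSpace ℂ (E₂ b)]
    (V₂ : ∀ b, (cmDatum L 2 J).L2 μ →ₗ[ℂ] (A₂ b × Lp (E₂ b) 2 (m₂ b)))
    (hV₂ : ∀ b, ∀ y ∈ (Submodule.span ℂ (gen₂ b)).topologicalClosure, V₂ b y = 0 → y = 0)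
    (Jb₂ : S₂ → Type*) [∀ b, Countable (Jb₂ b)]
    (h₂ : ∀ b, Jb₂ b → C_c(UnitaryGroup.arch (↥(maximalRealSubfield L)) L (IsCMField.complexConj L) 2 J, ℂ))
    (hhl₂ : ∀ b (j : Jb₂ b) (k : ↥(UnitaryGroup.arch (↥(maximalRealSubfield L)) L (IsCMField.complexConj L) 2 J ⊓ unitaryGroupOfForm (conjMixed (↥(maximalRealSubfield L)) L (IsCMField.complexConj L)) 1)) (x : UnitaryGroup.arch (↥(maximalRealSubfield L)) L (IsCMField.complexConj L) 2 J), h₂ b j ((Subgroup.inclusion (inf_le_left : UnitaryGroup.arch (↥(maximalRealSubfield L)) L (IsCMField.complexConj L) 2 J ⊓ unitaryGroupOfForm (conjMixed (↥(maximalRealSubfield L)) L (IsCMField.complexConj L)) 1 ≤ UnitaryGroup.arch (↥(maximalRealSubfield L)) L (IsCMField.complexConj L) 2 J)) k * x) = χ k * h₂ b j x)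
    (hhr₂ : ∀ b (j : Jb₂ b) (k : ↥(UnitaryGroup.arch (↥(maximalRealSubfield L)) L (IsCMField.complexConj L) 2 J ⊓ unitaryGroupOfForm (conjMixed (↥(maximalRealSubfield L)) L (IsCMField.complexConj L)) 1)) (x : UnitaryGroup.arch (↥(maximalRealSubfield L)) L (IsCMField.complexConj L) 2 J), h₂ b j (x * (Subgroup.inclusion (inf_le_left : UnitaryGroup.arch (↥(maximalRealSubfield L)) L (IsCMField.complexConj L) 2 J ⊓ unitaryGroupOfForm (conjMixed (↥(maximalRealSubfield L)) L (IsCMField.complexConj L)) 1 ≤ UnitaryGroup.arch (↥(maximalRealSubfield L)) L (IsCMField.complexConj L) 2 J)) k) = χ k * h₂ b j x)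
    (s₂ : ∀ b, Jb₂ b → Ω₂ b → ℂ) (hs₂ : ∀ b j, MemLp (s₂ b j) ∞ (m₂ b))
    (hU₂ : ∀ b j, ∀ v ∈ LinearMap.eqLocus (P : (cmDatum L 2 J).L2 μ →ₗ[ℂ] (cmDatum L 2 J).L2 μ) LinearMap.id,
      ((V₂ b ∘ₗ (((Submodule.span ℂ (gen₂ b)).topologicalClosure).starProjection : (cmDatum L 2 J).L2 μ →L[ℂ] (cmDatum L 2 J).L2 μ).toLinearMap) (((((cmDatum L 2 J).rightRegular μ).restrict (archToAdelic (↥(maximalRealSubfield L)) L (IsCMField.complexConj L) 2 J)).integratedOperator (((cmDatum L 2 J).isUnitary_rightRegular μ).restrict _) (((cmDatum L 2 J).isStronglyContinuous_rightRegular_holds μ).restrict _ (continuous_archToAdelic (↥(maximalRealSubfield L)) L (IsCMField.complexConj L) 2 J)) νinf (h₂ b j) ∘L (((cmDatum L 2 J).rightRegular μ).restrict (finAdelicToAdelic (↥(maximalRealSubfield L)) L (IsCMField.complexConj L) 2 J)).integratedOperator (((cmDatum L 2 J).isUnitary_rightRegular μ).restrict _) (((cmDatum L 2 J).isStronglyContinuous_rightRegular_holds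 μ).restrict _ (continuous_finAdelicToAdelic (↥(maximalRealSubfield L)) L (IsCMField.complexConj L) 2 J)) νf e) v)).2 = ((hs₂ b j).toLp (s₂ b j) • ((V₂ b ∘ₗ (((Submodule.span ℂ (gen₂ b)).topologicalClosure).starProjection : (cmDatum L 2 J).L2 μ →L[ℂ] (cmDatum L 2 J).L2 μ).toLinearMap) v).2 : Lp (E₂ b) 2 (m₂ b)))
    (hline₂ : ∀ b (c : Jb₂ b → ℂ), m₂ b {x | ∀ j, s₂ b j x = c j} = 0)
    (hEis : (((cmDatum L 2 J).cuspidalSubspace μ 𝔓).toSubmoduleᗮ ⊓ ((((cmDatum L 2 J).rightRegular μ)).restrict Kad.subtype).invariants) ≤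
      ((⨆ b, (Submodule.span ℂ (gen₁ b)).topologicalClosure) ⊔ (⨆ b, (Submodule.span ℂ (gen₂ b)).topologicalClosure)).topologicalClosure) :
    ∃ (P' : (cmDatum L 2 J).L2 μ →L[ℂ] (cmDatum L 2 J).L2 μ) (A' : Submodule ℂ ((cmDatum L 2 J).L2 μ)), FiniteDimensional ℂ A' ∧
      (∀ x : (cmDatum L 2 J).L2 μ, (∀ u ∈ (⟨K', hK'o⟩ : OpenSubgroup (finAdelic (↥(maximalRealSubfield L)) L (IsCMField.complexConj L) 2 J)), ((cmDatum L 2 J).rightRegular μ) ((MonoidHom.id (cmDatum L 2 J).Adelic) ((finAdelicToAdelic (↥(maximalRealSubfield L)) L (IsCMField.complexConj L) 2 J) u)) x = x) →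
        (∀ t : ↥(UnitaryGroup.arch (↥(maximalRealSubfield L)) L (IsCMField.complexConj L) 2 J ⊓ unitaryGroupOfForm (conjMixed (↥(maximalRealSubfield L)) L (IsCMField.complexConj L)) 1), ((cmDatum L 2 J).rightRegular μ) ((MonoidHom.id (cmDatum L 2 J).Adelic) (((archToAdelic (↥(maximalRealSubfield L)) L (IsCMField.complexConj L) 2 J).comp (Subgroup.inclusion (inf_le_left : UnitaryGroup.arch (↥(maximalRealSubfield L)) L (IsCMField.complexConj L) 2 J ⊓ unitaryGroupOfForm (conjMixed (↥(maximalRealSubfield L)) L (IsCMField.complexConj L)) 1 ≤ UnitaryGroup.arch (↥(maximalRealSubfield L)) L (IsCMField.complexConj L) 2 J))) t)) x = (1 : ↥(UnitaryGroup.arch (↥(maximalRealSubfield L)) L (IsCMField.complexConj L) 2 J ⊓ unitaryGroupOfForm (conjMixed (↥(maximalRealSubfield L)) L (IsCMField.complexConj L)) 1) →* ℂ) t • x) → P' x = x) ∧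
      ∀ W : ClosedSubrep (((cmDatum L 2 J).rightRegular μ)), W.toContRep.IsTopIrreducible → W ≤ residualSubspace (cmDatum L 2 J) μ 𝔓 → ∀ w ∈ W, P' w ∈ A' :=
  hatoms_of_noLineMass₂ (cmDatum L 2 J) μ 𝔓 (MonoidHom.id (cmDatum L 2 J).Adelic) ((archToAdelic (↥(maximalRealSubfield L)) L (IsCMField.complexConj L) 2 J).comp (Subgroup.inclusion (inf_le_left : UnitaryGroup.arch (↥(maximalRealSubfield L)) L (IsCMField.complexConj L) 2 J ⊓ unitaryGroupOfForm (conjMixed (↥(maximalRealSubfield L)) L (IsCMField.complexConj L)) 1 ≤ UnitaryGroup.arch (↥(maximalRealSubfield L)) L (IsCMField.complexConj L) 2 J))) (finAdelicToAdelic (↥(maximalRealSubfield L)) L (IsCMField.complexConj L) 2 J) (1 : ↥(UnitaryGroup.arch (↥(maximalRealSubfield L)) L (IsCMField.complexConj L) 2 J ⊓ unitaryGroupOfForm (conjMixed (↥(maximalRealSubfield L)) L (IsCMField.complexConj L)) 1) →* ℂ) ⟨K', hK'o⟩ P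
    (hPfix_trivialKType μ νf (Subgroup.inclusion (inf_le_left : UnitaryGroup.arch (↥(maximalRealSubfield L)) L (IsCMField.complexConj L) 2 J ⊓ unitaryGroupOfForm (conjMixed (↥(maximalRealSubfield L)) L (IsCMField.complexConj L)) 1 ≤ UnitaryGroup.arch (↥(maximalRealSubfield L)) L (IsCMField.complexConj L) 2 J)) (continuous_induced_rng.2 continuous_subtype_val) μK χ e hχ1 K' hK'o he0 he1 P hPdef)
    (((cmDatum L 2 J).cuspidalSubspace μ 𝔓).toSubmoduleᗮ ⊓ ((((cmDatum L 2 J).rightRegular μ)).restrict Kad.subtype).invariants)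
    (fun b => (V₁ b ∘ₗ (((Submodule.span ℂ (gen₁ b)).topologicalClosure).starProjection : (cmDatum L 2 J).L2 μ →L[ℂ] (cmDatum L 2 J).L2 μ).toLinearMap)) (fun b => (V₂ b ∘ₗ (((Submodule.span ℂ (gen₂ b)).topologicalClosure).starProjection : (cmDatum L 2 J).L2 μ →L[ℂ] (cmDatum L 2 J).L2 μ).toLinearMap))
    (hEXH₂ (fun b => (Submodule.span ℂ (gen₁ b)).topologicalClosure) (fun b => (Submodule.span ℂ (gen₂ b)).topologicalClosure) (((cmDatum L 2 J).cuspidalSubspace μ 𝔓).toSubmoduleᗮ ⊓ ((((cmDatum L 2 J).rightRegular μ)).restrict Kad.subtype).invariants) hEis V₁ hV₁ V₂ hV₂)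
    (hPEis_of_letters μ νf (Subgroup.inclusion (inf_le_left : UnitaryGroup.arch (↥(maximalRealSubfield L)) L (IsCMField.complexConj L) 2 J ⊓ unitaryGroupOfForm (conjMixed (↥(maximalRealSubfield L)) L (IsCMField.complexConj L)) 1 ≤ UnitaryGroup.arch (↥(maximalRealSubfield L)) L (IsCMField.complexConj L) 2 J)) (continuous_induced_rng.2 continuous_subtype_val) μK χ e (hχmul_of_one χ hχ1) (hχ1 1) K' he0 he1 heK P hPdef 𝔓 (((cmDatum L 2 J).cuspidalSubspace μ 𝔓).toSubmoduleᗮ ⊓ ((((cmDatum L 2 J).rightRegular μ)).restrict Kad.subtype).invariants)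
      (hEisdef_of_trivial_kType μ νf (Subgroup.inclusion (inf_le_left : UnitaryGroup.arch (↥(maximalRealSubfield L)) L (IsCMField.complexConj L) 2 J ⊓ unitaryGroupOfForm (conjMixed (↥(maximalRealSubfield L)) L (IsCMField.complexConj L)) 1 ≤ UnitaryGroup.arch (↥(maximalRealSubfield L)) L (IsCMField.complexConj L) 2 J)) (continuous_induced_rng.2 continuous_subtype_val) μK χ e hχ1 K' heK P hPdef 𝔓 Kad hKad))
    (hD5_letterFree_two J μ νinf νf μK χ e hJc hJ2 hJw hχ1 K' he0 he1 heK hestar P hPdef 𝔓 gen₁ m₁ V₁ Jb₁ h₁ hhl₁ hhr₁ s₁ hs₁ hU₁ hline₁)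
    (hD5_letterFree_two J μ νinf νf μK χ e hJc hJ2 hJw hχ1 K' he0 he1 heK hestar P hPdef 𝔓 gen₂ m₂ V₂ Jb₂ h₂ hhl₂ hhr₂ s₂ hs₂ hU₂ hline₂)

/-- **RUNG 1, TWO-FAMILY PLUG EDITION**: «the `K′`-invariant, `K_∞`-invariant part of `L²_res(U(J)_{L∕L⁺}, 𝔓)` is FINITE-DIMENSIONAL», modulo `hKad`, `hEis` over both families (★ C7 NAMED + the
OD∕SD split of `S(K′)`), block coordinates injective on the blocks, and the per-block model letters of EACH family. [cite: MoeglinWaldspurger1995, I.2.18, V.3.13] [cite: HarishChandra1968, Thm. 1] -/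
theorem residual_invariants_finiteDimensional_letterFree_of_twoBlockFamilies [MeasurableMul (finAdelic (↥(maximalRealSubfield L)) L (IsCMField.complexConj L) 2 J)] [ENNReal.HolderTriple ∞ 2 2]
    (hJc : J.map (IsCMField.complexConj L : L → L) = J) (hJ2 : J * J = 1)
    (hJw : ∀ w : {w : InfinitePlace L // IsComplex w}, J.map w.1.embedding = !![(0 : ℂ), 1; 1, 0])
    (hχ1 : ∀ k, χ k = 1)
    (K' : Subgroup (finAdelic (↥(maximalRealSubfield L)) L (IsCMField.complexConj L) 2 J)) (hK'o : IsOpen (K' : Set (finAdelic (↥(maximalRealSubfield L)) L (IsCMField.complexConj L) 2 J))) (he0 : ∀ x, x ∉ K' → e x = 0) (he1 : ∫ x, e x ∂νf = 1)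
    (heK : ∀ k ∈ K', ∀ x, e (k * x) = e x) (hestar : ∀ x, mulStar (⇑e) x = e x)
    (P : (cmDatum L 2 J).L2 μ →L[ℂ] (cmDatum L 2 J).L2 μ) (hPdef : P = ((((cmDatum L 2 J).rightRegular μ).restrict ((archToAdelic (↥(maximalRealSubfield L)) L (IsCMField.complexConj L) 2 J).comp (Subgroup.inclusion (inf_le_left : UnitaryGroup.arch (↥(maximalRealSubfield L)) L (IsCMField.complexConj L) 2 J ⊓ unitaryGroupOfForm (conjMixed (↥(maximalRealSubfield L)) L (IsCMField.complexConj L)) 1 ≤ UnitaryGroup.arch (↥(maximalRealSubfield L)) L (IsCMField.complexConj L) 2 J)))).integratedOperator (((cmDatum L 2 J).isUnitary_rightRegular μ).restrict _)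
          (((cmDatum L 2 J).isStronglyContinuous_rightRegular_holds μ).restrict _ ((continuous_archToAdelic (↥(maximalRealSubfield L)) L (IsCMField.complexConj L) 2 J).comp (continuous_induced_rng.2 continuous_subtype_val))) μK χ ∘L
        (((cmDatum L 2 J).rightRegular μ).restrict (finAdelicToAdelic (↥(maximalRealSubfield L)) L (IsCMField.complexConj L) 2 J)).integratedOperator (((cmDatum L 2 J).isUnitary_rightRegular μ).restrict _) (((cmDatum L 2 J).isStronglyContinuous_rightRegular_holds μ).restrict _ (continuous_finAdelicToAdelic (↥(maximalRealSubfield L)) L (IsCMField.complexConj L) 2 J)) νf e))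
    (𝔓 : (cmDatum L 2 J).ParabolicUnipotentData)
    (Kad : Subgroup (cmDatum L 2 J).Adelic) (hKad : Kad ≤ (Subgroup.closure (Set.range (fun k : ↥(UnitaryGroup.arch (↥(maximalRealSubfield L)) L (IsCMField.complexConj L) 2 J ⊓ unitaryGroupOfForm (conjMixed (↥(maximalRealSubfield L)) L (IsCMField.complexConj L)) 1) => (archToAdelic (↥(maximalRealSubfield L)) L (IsCMField.complexConj L) 2 J) ((Subgroup.inclusion (inf_le_left : UnitaryGroup.arch (↥(maximalRealSubfield L)) L (IsCMField.complexConj L) 2 J ⊓ unitaryGroupOfForm (conjMixed (↥(maximalRealSubfield L)) L (IsCMField.complexConj L)) 1 ≤ UnitaryGroup.arch (↥(maximalRealSubfield L)) L (IsCMField.complexConj L) 2 J)) k)) ∪ (finAdelicToAdelic (↥(maximalRealSubfield L)) L (IsCMField.complexConj L) 2 J) '' (K' : Set (finAdelic (↥(maximalRealSubfield L)) L (IsCMField.complexConj L) 2 J)))))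
    {S₁ : Type*} (gen₁ : S₁ → Set ((cmDatum L 2 J).L2 μ))
    {A₁ : S₁ → Type*} [∀ b, AddCommGroup (A₁ b)] [∀ b, Module ℂ (A₁ b)] [∀ b, Subsingleton (A₁ b)]
    {Ω₁ : S₁ → Type*} {mΩ₁ : ∀ b, MeasurableSpace (Ω₁ b)} (m₁ : ∀ b, Measure (Ω₁ b)) {E₁ : S₁ → Type*} [∀ b, NormedAddCommGroup (E₁ b)] [∀ b, NormedSpace ℂ (E₁ b)]
    (V₁ : ∀ b, (cmDatum L 2 J).L2 μ →ₗ[ℂ] (A₁ b × Lp (E₁ b) 2 (m₁ b)))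
    (hV₁ : ∀ b, ∀ y ∈ (Submodule.span ℂ (gen₁ b)).topologicalClosure, V₁ b y = 0 → y = 0)
    (Jb₁ : S₁ → Type*) [∀ b, Countable (Jb₁ b)]
    (h₁ : ∀ b, Jb₁ b → C_c(UnitaryGroup.arch (↥(maximalRealSubfield L)) L (IsCMField.complexConj L) 2 J, ℂ))
    (hhl₁ : ∀ b (j : Jb₁ b) (k : ↥(UnitaryGroup.arch (↥(maximalRealSubfield L)) L (IsCMField.complexConj L) 2 J ⊓ unitaryGroupOfForm (conjMixed (↥(maximalRealSubfield L)) L (IsCMField.complexConj L)) 1)) (x : UnitaryGroup.arch (↥(maximalRealSubfield L)) L (IsCMField.complexConj L) 2 J), h₁ b j ((Subgroup.inclusion (inf_le_left : UnitaryGroup.arch (↥(maximalRealSubfield L)) L (IsCMField.complexConj L) 2 J ⊓ unitaryGroupOfForm (conjMixed (↥(maximalRealSubfield L)) L (IsCMField.complexConj L)) 1 ≤ UnitaryGroup.arch (↥(maximalRealSubfield L)) L (IsCMField.complexConj L) 2 J)) k * x) = χ k * h₁ b j x)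
    (hhr₁ : ∀ b (j : Jb₁ b) (k : ↥(UnitaryGroup.arch (↥(maximalRealSubfield L)) L (IsCMField.complexConj L) 2 J ⊓ unitaryGroupOfForm (conjMixed (↥(maximalRealSubfield L)) L (IsCMField.complexConj L)) 1)) (x : UnitaryGroup.arch (↥(maximalRealSubfield L)) L (IsCMField.complexConj L) 2 J), h₁ b j (x * (Subgroup.inclusion (inf_le_left : UnitaryGroup.arch (↥(maximalRealSubfield L)) L (IsCMField.complexConj L) 2 J ⊓ unitaryGroupOfForm (conjMixed (↥(maximalRealSubfield L)) L (IsCMField.complexConj L)) 1 ≤ UnitaryGroup.arch (↥(maximalRealSubfield L)) L (IsCMField.complexConj L) 2 J)) k) = χ k * h₁ b j x)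
    (s₁ : ∀ b, Jb₁ b → Ω₁ b → ℂ) (hs₁ : ∀ b j, MemLp (s₁ b j) ∞ (m₁ b))
    (hU₁ : ∀ b j, ∀ v ∈ LinearMap.eqLocus (P : (cmDatum L 2 J).L2 μ →ₗ[ℂ] (cmDatum L 2 J).L2 μ) LinearMap.id,
      ((V₁ b ∘ₗ (((Submodule.span ℂ (gen₁ b)).topologicalClosure).starProjection : (cmDatum L 2 J).L2 μ →L[ℂ] (cmDatum L 2 J).L2 μ).toLinearMap) (((((cmDatum L 2 J).rightRegular μ).restrict (archToAdelic (↥(maximalRealSubfield L)) L (IsCMField.complexConj L) 2 J)).integratedOperator (((cmDatum L 2 J).isUnitary_rightRegular μ).restrict _) (((cmDatum L 2 J).isStronglyContinuous_rightRegular_holds μ).restrict _ (continuous_archToAdelic (↥(maximalRealSubfield L)) L (IsCMField.complexConj L) 2 J)) νinf (h₁ b j) ∘L (((cmDatum L 2 J).rightRegular μ).restrict (finAdelicToAdelic (↥(maximalRealSubfield L)) L (IsCMField.complexConj L) 2 J)).integratedOperator (((cmDatum L 2 J).isUnitary_rightRegular μ).restrict _) (((cmDatum L 2 J).isStronglyContinuous_rightRegular_holds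 μ).restrict _ (continuous_finAdelicToAdelic (↥(maximalRealSubfield L)) L (IsCMField.complexConj L) 2 J)) νf e) v)).2 = ((hs₁ b j).toLp (s₁ b j) • ((V₁ b ∘ₗ (((Submodule.span ℂ (gen₁ b)).topologicalClosure).starProjection : (cmDatum L 2 J).L2 μ →L[ℂ] (cmDatum L 2 J).L2 μ).toLinearMap) v).2 : Lp (E₁ b) 2 (m₁ b)))
    (hline₁ : ∀ b (c : Jb₁ b → ℂ), m₁ b {x | ∀ j, s₁ b j x = c j} = 0)
    {S₂ : Type*} [Finite S₂] (gen₂ : S₂ → Set ((cmDatum L 2 J).L2 μ))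
    {A₂ : S₂ → Type*} [∀ b, AddCommGroup (A₂ b)] [∀ b, Module ℂ (A₂ b)] [∀ b, FiniteDimensional ℂ (A₂ b)]
    {Ω₂ : S₂ → Type*} {mΩ₂ : ∀ b, MeasurableSpace (Ω₂ b)} (m₂ : ∀ b, Measure (Ω₂ b)) {E₂ : S₂ → Type*} [∀ b, NormedAddCommGroup (E₂ b)] [∀ b, NormedSpace ℂ (E₂ b)]
    (V₂ : ∀ b, (cmDatum L 2 J).L2 μ →ₗ[ℂ] (A₂ b × Lp (E₂ b) 2 (m₂ b)))
    (hV₂ : ∀ b, ∀ y ∈ (Submodule.span ℂ (gen₂ b)).topologicalClosure, V₂ b y = 0 → y = 0)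
    (Jb₂ : S₂ → Type*) [∀ b, Countable (Jb₂ b)]
    (h₂ : ∀ b, Jb₂ b → C_c(UnitaryGroup.arch (↥(maximalRealSubfield L)) L (IsCMField.complexConj L) 2 J, ℂ))
    (hhl₂ : ∀ b (j : Jb₂ b) (k : ↥(UnitaryGroup.arch (↥(maximalRealSubfield L)) L (IsCMField.complexConj L) 2 J ⊓ unitaryGroupOfForm (conjMixed (↥(maximalRealSubfield L)) L (IsCMField.complexConj L)) 1)) (x : UnitaryGroup.arch (↥(maximalRealSubfield L)) L (IsCMField.complexConj L) 2 J), h₂ b j ((Subgroup.inclusion (inf_le_left : UnitaryGroup.arch (↥(maximalRealSubfield L)) L (IsCMField.complexConj L) 2 J ⊓ unitaryGroupOfForm (conjMixed (↥(maximalRealSubfield L)) L (IsCMField.complexConj L)) 1 ≤ UnitaryGroup.arch (↥(maximalRealSubfield L)) L (IsCMField.complexConj L) 2 J)) k * x) = χ k * h₂ b j x)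
    (hhr₂ : ∀ b (j : Jb₂ b) (k : ↥(UnitaryGroup.arch (↥(maximalRealSubfield L)) L (IsCMField.complexConj L) 2 J ⊓ unitaryGroupOfForm (conjMixed (↥(maximalRealSubfield L)) L (IsCMField.complexConj L)) 1)) (x : UnitaryGroup.arch (↥(maximalRealSubfield L)) L (IsCMField.complexConj L) 2 J), h₂ b j (x * (Subgroup.inclusion (inf_le_left : UnitaryGroup.arch (↥(maximalRealSubfield L)) L (IsCMField.complexConj L) 2 J ⊓ unitaryGroupOfForm (conjMixed (↥(maximalRealSubfield L)) L (IsCMField.complexConj L)) 1 ≤ UnitaryGroup.arch (↥(maximalRealSubfield L)) L (IsCMField.complexConj L) 2 J)) k) = χ k * h₂ b j x)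
    (s₂ : ∀ b, Jb₂ b → Ω₂ b → ℂ) (hs₂ : ∀ b j, MemLp (s₂ b j) ∞ (m₂ b))
    (hU₂ : ∀ b j, ∀ v ∈ LinearMap.eqLocus (P : (cmDatum L 2 J).L2 μ →ₗ[ℂ] (cmDatum L 2 J).L2 μ) LinearMap.id,
      ((V₂ b ∘ₗ (((Submodule.span ℂ (gen₂ b)).topologicalClosure).starProjection : (cmDatum L 2 J).L2 μ →L[ℂ] (cmDatum L 2 J).L2 μ).toLinearMap) (((((cmDatum L 2 J).rightRegular μ).restrict (archToAdelic (↥(maximalRealSubfield L)) L (IsCMField.complexConj L) 2 J)).integratedOperator (((cmDatum L 2 J).isUnitary_rightRegular μ).restrict _) (((cmDatum L 2 J).isStronglyContinuous_rightRegular_holds μ).restrict _ (continuous_archToAdelic (↥(maximalRealSubfield L)) L (IsCMField.complexConj L) 2 J)) νinf (h₂ b j) ∘L (((cmDatum L 2 J).rightRegular μ).restrict (finAdelicToAdelic (↥(maximalRealSubfield L)) L (IsCMField.complexConj L) 2 J)).integratedOperator (((cmDatum L 2 J).isUnitary_rightRegular μ).restrict _) (((cmDatum L 2 J).isStronglyContinuous_rightRegular_holds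 μ).restrict _ (continuous_finAdelicToAdelic (↥(maximalRealSubfield L)) L (IsCMField.complexConj L) 2 J)) νf e) v)).2 = ((hs₂ b j).toLp (s₂ b j) • ((V₂ b ∘ₗ (((Submodule.span ℂ (gen₂ b)).topologicalClosure).starProjection : (cmDatum L 2 J).L2 μ →L[ℂ] (cmDatum L 2 J).L2 μ).toLinearMap) v).2 : Lp (E₂ b) 2 (m₂ b)))
    (hline₂ : ∀ b (c : Jb₂ b → ℂ), m₂ b {x | ∀ j, s₂ b j x = c j} = 0)
    (hEis : (((cmDatum L 2 J).cuspidalSubspace μ 𝔓).toSubmoduleᗮ ⊓ ((((cmDatum L 2 J).rightRegular μ)).restrict Kad.subtype).invariants) ≤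
      ((⨆ b, (Submodule.span ℂ (gen₁ b)).topologicalClosure) ⊔ (⨆ b, (Submodule.span ℂ (gen₂ b)).topologicalClosure)).topologicalClosure) :
    FiniteDimensional ℂ ↥((residualSubspace (cmDatum L 2 J) μ 𝔓).toSubmodule ⊓
      ((((cmDatum L 2 J).rightRegular μ)).restrict ((finAdelicToAdelic (↥(maximalRealSubfield L)) L (IsCMField.complexConj L) 2 J).comp K'.subtype)).invariants ⊓
      ((((cmDatum L 2 J).rightRegular μ)).restrict ((archToAdelic (↥(maximalRealSubfield L)) L (IsCMField.complexConj L) 2 J).comp (Subgroup.inclusion (inf_le_left : UnitaryGroup.arch (↥(maximalRealSubfield L)) L (IsCMField.complexConj L) 2 J ⊓ unitaryGroupOfForm (conjMixed (↥(maximalRealSubfield L)) L (IsCMField.complexConj L)) 1 ≤ UnitaryGroup.arch (↥(maximalRealSubfield L)) L (IsCMField.complexConj L) 2 J)))).invariants) := by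
  obtain ⟨P', A', hA', hfix, hmem⟩ := hatoms_trivialKType_letterFree_of_twoBlockFamilies J μ νinf νf μK χ e hJc hJ2 hJw
    hχ1 K' hK'o he0 he1 heK hestar P hPdef 𝔓 Kad hKad gen₁ m₁ V₁ hV₁ Jb₁ h₁ hhl₁ hhr₁ s₁ hs₁ hU₁ hline₁ gen₂ m₂ V₂ hV₂ Jb₂ h₂ hhl₂ hhr₂ s₂ hs₂ hU₂ hline₂ hEis
  refine K2E1ResidualSphericalFiniteMaximalLevelCMTwo.residual_invariants_finiteDimensional_of_atoms (cmDatum L 2 J) μ 𝔓 ((archToAdelic (↥(maximalRealSubfield L)) L (IsCMField.complexConj L) 2 J).comp (Subgroup.inclusion (inf_le_left : UnitaryGroup.arch (↥(maximalRealSubfield L)) L (IsCMField.complexConj L) 2 J ⊓ unitaryGroupOfForm (conjMixed (↥(maximalRealSubfield L)) L (IsCMField.complexConj L)) 1 ≤ UnitaryGroup.arch (↥(maximalRealSubfield L)) L (IsCMField.complexConj L) 2 J))) (finAdelicToAdelic (↥(maximalRealSubfield L)) L (IsCMField.complexConj L) 2 J) K'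
    ⟨P', A', hA', fun x hxU hxK => hfix x (fun u hu => hxU u hu) (fun t => ?_), hmem⟩
  rw [MonoidHom.one_apply, one_smul]
  exact hxK t

end CM

end Summit.HodgeConjecture.HodgeConjecture.Cruxes.H413.K2E1ResidualSphericalFiniteOfTwoBlockFamilies

end
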